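import Literature.MathematicalPhysics.QuantumFieldTheory.Balaban1983to89.B8Eq154Local

/-!
# `Balaban1983to89.B8Prop7ClassAkLocal` — [Balaban1985RegularSpaces] Sect. G p. 100: (1.141), (1.142) «on Ω_j» and
# the `𝔄_k`-clause of Proposition 7 (1.144) for a GENERAL admissible family `{Ω_j}` from the LEVEL-WISE hypotheses
# (1.139) `U₀ ∈ 𝔄_k({Ω_j}, α₀)` and (1.140) «on Ω_j»

statement-level skeleton of published theorems with citation tags; proofs where landed; nothing here is a claim about the Yang–Mills mass gap

T. Bałaban, *Spaces of regular gauge field configurations on a lattice and gauge fixing conditions*, Commun.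
Math. Phys. **99** (1985) 75–102 `[Balaban1985RegularSpaces]` ("B8"; printed page = PDF page + 74).
PDF held: `paper:balaban1985-cmp99-regular-spaces-gauge-fixing` (lit store), pp. 77 and 100 read as text
(`p0003.txt`, `p0026.txt`).  STATUS: published, refereed; this file ASSEMBLES (1.141)/(1.142) and the first clause
of (1.144) from the bond-local basic estimate `B8Eq154Local.eq154_printed_loc` and the plaquette-local (1.43)/(1.47)
— the LOCALISATION that the gen-4 companions `B8Ineq1141SectG`/`B8Ineq1144ClassAk` left open (their HONEST SCOPE
(i): «(1.139)/(1.140) enter at ONE level on the whole lattice … The localisation … to a general admissible family …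
is NOT reproduced»).  Nothing here is new mathematics and nothing here is a claim about the Clay problem.

WHAT IS REPRODUCED (lit-balaban SKELETON rows): **B8.Eq1.141-1.143** ((1.141), (1.142) «on Ω_j» with level-wise
hypotheses) and **B8.Prop7**, `𝔄_k`-clause of (1.144) «U′U₀ = (U₁U₀)^u ∈ 𝔄_k({Ω_j}, α₀ + 3α₂)» for a GENERAL family
`{Ω_j}_{j ≤ k}` from (1.139) = `B8Ineq132.InAk L k η α₀ Ω U₀` and (1.140) = `Cond140 L η α₂ j (Ω j) U₀ A` at every
level `j ≤ k` (`B8Eq140Level.Cond140`).  Unit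
`lit-balaban-p40` (Phase-2 proof seat p40, gen 5), HOME `run/shared/lean/pub/lit-balaban/`.

## THE PRINTED TEXT (p. 100 [PDF 26], quoted from the text layer; p. 77 for the conventions)

«We assume that we are given a gauge field configuration U₀, U₀ ∈ 𝔄_k({Ω_j}, α₀), (1.139) and a Lie algebra valued
configuration A satisfying Lʲη|A|, (Lʲη)²|∇^η_{U₀}A|, (Lʲη)³|D^{η*}_{U₀}D^η_{U₀}A| < α₂ on Ω_j. (1.140)
We consider the configuration U₁U₀, U₁ = e^{iηA}. … The identity (1.21), the bound (1.47) and the assumptions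
(1.139), (1.140) imply |(U₁U₀)(∂p) − 1| ≦ |U₀(∂p) − 1| + η²|(D^η_{U₀}A)(p)| + ½(η∂|A|(p))² < (α₀ + 2α₂ + 8α₂²)L^{−2j}
on Ω_j. (1.141)  The basic estimate (1.54) and the assumptions imply
|D^{η*}_{U₁U₀}∂U₁U₀| < (α₀ + α₂ + 36dα₂² + 50dα₂³ + 10dα₀α₂)(Lʲη)⁻³η². (1.142)  To simplify formulations we assume
that α₀, α₂ are so small that α₀ + 2α₂ + 8α₂² ≦ α₀ + 3α₂, α₀ + α₂ + 36dα₂² + 50dα₂³ + 10dα₀α₂ ≦ α₀ + 2α₂. …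
Proposition 7. If the configurations U₀, A satisfy (1.139), (1.140), then for α₀, α₂ sufficiently small we have
U′U₀ = (U₁U₀)^u ∈ 𝔄_k({Ω_j}, α₀ + 3α₂) ∩ Ax_k(𝔅_k, U₀), (1.144)»
(p. 77: «If Ω ⊂ T_η, then we denote by Ω also the set of bonds ⋃_{x∈Ω} st(x) = {bonds b ⊂ T_η: at least one
end-point of b belongs to Ω}. Similarly for the corresponding set of plaquettes.»)

## WHAT IS CERTIFIED HERE (kernel; axioms `propext` / `Classical.choice` / `Quot.sound`)

On the `ℤ^d` carriers of the lineage (as in `B8Ineq132`), for a site set `S` (print: `Ω_j`), with the geometry and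
the level-wise (1.140) of `B8Eq140Level` (`SideTouches S` = the sides of the plaquettes touching `S`, `Cond140`) and the
bond-local basic estimate of `B8Eq154Local`:
* §1 **(1.141) «on Ω_j»**: `ineq1141_pointwise_loc` / `ineq1141_loc` at a plaquette from the data on ITS four sides
  and its two gradient entries, `ineq1141_lt_loc` («≦ α₀ + 3α₂»: `< (α₀ + 3α₂)L^{−2j}` for `α₀ ≤ 1/8`, `α₂ ≤ 1/20`).
* §2 **(1.142) «on Ω_j»**: `ineq1142_pointwise_loc` / `ineq1142_lt_loc` at a bond from the data on the plaquettes
  through it (`B8Eq154Local.eq154_printed_loc`), `< (α₀ + 2α₂)L^{−2j}(Lʲη)⁻¹` for `α₀, α₂ ≤ 1/(80d)`.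
* §3 **(1.144), `𝔄_k`-clause, LEVEL-WISE**: `condAt_mulCfg_loc` — `CondAt α₀ j S U₀ ∧ Cond140 α₂ j S U₀ A` (+ the
  (1.41)-bookkeeping `|U₁ − 1| ≤ α₂(Lʲη)⁻¹η` on `SideTouches S`) ⇒ `CondAt (α₀ + 3α₂) j S (U₁U₀)`; **`inAk_mulCfg_loc`** —
  `U₀ ∈ 𝔄_k({Ω_j}, α₀)` and (1.140) on `Ω_j` for every `j ≤ k` ⇒ `U₁U₀ ∈ 𝔄_k({Ω_j}, α₀ + 3α₂)`;
  `inAk_mulCfg_gaugeAct_loc` — the same for `(U₁U₀)^u`, every `U1`-valued `u` (gauge invariance of `𝔄_k`, p. 77).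
* §4 the HERMITIAN case (`𝔸` a C⋆-algebra, `A` self-adjoint; `U₁ = e^{iηA}` unitary and `|U₁ − 1| ≤ η|A|`
  discharged): `inAk_mulCfg_hermitian_loc`, `inAk_mulCfg_gaugeAct_hermitian_loc`, and **`prop7_classAk_loc`** — the
  sentence shape of `B8SectGH.Prop7PrintedR` restricted to its `𝔄_k`-clause with PRINT'S LEVEL-WISE HYPOTHESES:
  `∃ c > 0` (`c = 1/(80d)`) such that for `0 < α₀, α₂ ≤ c`, `U₀ ∈ 𝔄_k({Ω_j}, α₀)` and (1.140) on every `Ω_j` imply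
  `(U₁U₀)^u ∈ 𝔄_k({Ω_j}, α₀ + 3α₂)` for every `U1`-valued `u`.

## HONEST SCOPE / LOCATED READING — what is NOT claimed

(i) «ON Ω_j» FOR `|A|`, `|∇^η_{U₀}A|` IS READ ONE LAYER WIDER THAN p. 77's BOND CONVENTION: at a plaquette `p`
touching `Ω_j` in one corner `x` only, (1.141)'s third summand `½(η∂|A|(p))²` needs `|A|` on all four sides of `p`,
two of which (`⟨x + e_μ, x + e_μ + e_ν⟩`, `⟨x + e_ν, x + e_ν + e_μ⟩`) have no end-point in `Ω_j`; likewise (1.46)–(1.54)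
at a bond touching `Ω_j` read `A` on all sides of the plaquettes through it.  Print's constants `8α₂²`, `36d`, `50d`
presuppose the bound `α₂(Lʲη)⁻¹` there; `Cond140` therefore quantifies `|A|`, `|∇A|` over `SideTouches Ω_j` = the sides of
the plaquettes touching `Ω_j` (⊇ the bonds touching `Ω_j`).  Under print's literal convention the missing bonds are
controlled at level `j − 1` (on `Ω_{j−1} ⊇` the one-layer enlargement of `Ω_j` by (1.4)) with the weaker threshold
`α₂(L^{j−1}η)⁻¹ = Lα₂(Lʲη)⁻¹`, which changes the constants by `L`-dependent factors and needs `Ω₀ = T_η` at the bottom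
level — not reproduced (GAPS.md).  (ii) The `Ax_k(𝔅_k, U₀)`-clause of (1.144) and (1.145) are not in this
file (r05's `B8Ineq145*` / `B8Prop7AdmittedFamily` lane; (1.145) is refuted as printed on crossing bonds, G-B8-01);
by gauge invariance the `𝔄_k`-clause holds for `(U₁U₀)^u` with ANY `U1`-valued `u`.  (iii) Thresholds as in the
gen-4 companion: `α₀ ≤ 1/8, α₂ ≤ 1/20` (plaquettes), `α₀, α₂ ≤ 1/(80d)` (bonds); the strict `<` for `U₁U₀` comes from
the strict (1.139).  (iv) `U₀` is `U1`-valued everywhere (structural); `T_η` ↦ `ℤ^d`, `η > 0` explicit.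
-/

noncomputable section

open scoped BigOperators
open NormedSpace Finset

namespace Literature.MathematicalPhysics.QuantumFieldTheory.Balaban1983to89.B8Prop7ClassAkLocal

open B7Prop1Explicit
open B8Lemma1NonAbelian (mulCfg)
open B8Ineq132 (plaqF covDeriv covDerivFwd covDiv CondAt InAk PlaqTouches BondTouches condAt_mono
  inAk_gaugeAct_iff)
open B8Eq143PlaqExpansion (pdiv covPlaq rem43 eq143)
open B8Eq146AExpansion (expCfg iEta plaqCovDeriv plaqCovDeriv_eq_covDerivFwd eq147_ord1_printed)
open B8Eq155JBound (norm_I_eta_sq_smul)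
open B8Ineq1141SectG (inv_mul_eta_le_one eta_sq_mul_inv_sq eta_sq_mul_inv_cube)
open B8Ineq1144ClassAk (plaq_slack_le bond_slack_le)
open B8Eq140Level
open B8Eq148Local
open B8Eq154Local

-- `Site` alone would resolve to the torus sites of `Setup.lean`; re-export the `ℤ^d` sites of `B7Prop1Explicit`.
export B7Prop1Explicit (Site)

variable {d : ℕ}

/-! ## §1 (1.141) at one plaquette from the data on its sides -/

section Plaquette

variable {𝔸 : Type*} [NormedRing 𝔸] [NormOneClass 𝔸] [NormedAlgebra ℂ 𝔸] [CompleteSpace 𝔸]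

/-- **(1.141), pointwise sharp form, LOCAL**: `B8Ineq1141SectG.ineq1141_pointwise` with `|U₁ − 1| ≤ u` on the four
sides of the plaquette only:
`|(U₁U₀)(∂p) − 1| ≤ (1 + 4u)|U₀(∂p) − 1| + η²|(D^η_{U₀}A)(p)| + ½s²(1 + (4/9)s)`, `s = η∂|A|(p) ≤ 1`.
[cite: Balaban1985RegularSpaces, (1.141) p.100] -/
theorem ineq1141_pointwise_loc {η : ℝ} (hη : 0 < η) {U₀ : Site d → Fin d → 𝔸ˣ} (h₀ : ∀ y κ, U₀ y κ ∈ U1 𝔸)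
    (A : Site d → Fin d → 𝔸) (h₁ : ∀ y κ, expCfg (iEta η A) y κ ∈ U1 𝔸) {u : ℝ} {μ ν : Fin d} {x : Site d}
    (hu : ∀ y τ, IsSide x μ ν y τ → ‖(expCfg (iEta η A) y τ : 𝔸) - 1‖ ≤ u)
    (hs : η * (‖A x μ‖ + ‖A (x + e μ) ν‖ + ‖A (x + e ν) μ‖ + ‖A x ν‖) ≤ 1) :
    ‖plaqF (mulCfg (expCfg (iEta η A)) U₀) μ ν x - 1‖ ≤
      (1 + 4 * u) * ‖plaqF U₀ μ ν x - 1‖ + η ^ 2 * ‖plaqCovDeriv η U₀ A μ ν x‖ +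
        (η * (‖A x μ‖ + ‖A (x + e μ) ν‖ + ‖A (x + e ν) μ‖ + ‖A x ν‖)) ^ 2 / 2 *
          (1 + 4 / 9 * (η * (‖A x μ‖ + ‖A (x + e μ) ν‖ + ‖A (x + e ν) μ‖ + ‖A x ν‖))) := by
  set U₁ := expCfg (iEta η A) with hU₁
  set s := η * (‖A x μ‖ + ‖A (x + e μ) ν‖ + ‖A (x + e ν) μ‖ + ‖A x ν‖)
  set P := plaqF U₀ μ ν x - 1
  set D := ((Complex.I : ℂ) * η ^ 2) • plaqCovDeriv η U₀ A μ ν x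
  set C := ((covPlaq U₀ U₁ μ ν x : 𝔸ˣ) : 𝔸) - 1
  have hrem : ‖rem43 U₀ U₁ μ ν x‖ ≤ 4 * u * ‖P‖ := norm_rem43_le_loc h₀ h₁ hu le_rfl
  have hcov : ‖C - D‖ ≤ s ^ 2 / 2 * (1 + 4 / 9 * s) := eq147_ord1_printed hη h₀ A μ ν x hs
  have hD : ‖D‖ = η ^ 2 * ‖plaqCovDeriv η U₀ A μ ν x‖ := norm_I_eta_sq_smul η _
  have h143 : plaqF (mulCfg U₁ U₀) μ ν x - 1 = rem43 U₀ U₁ μ ν x + P + C := eq143 U₀ U₁ μ ν x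
  have hC : ‖C‖ ≤ ‖C - D‖ + ‖D‖ := by
    calc ‖C‖ = ‖C - D + D‖ := by rw [sub_add_cancel]
      _ ≤ ‖C - D‖ + ‖D‖ := norm_add_le _ _
  calc ‖plaqF (mulCfg U₁ U₀) μ ν x - 1‖ = ‖rem43 U₀ U₁ μ ν x + P + C‖ := by rw [h143]
    _ ≤ ‖rem43 U₀ U₁ μ ν x‖ + ‖P‖ + ‖C‖ := norm_add₃_le
    _ ≤ 4 * u * ‖P‖ + ‖P‖ + (s ^ 2 / 2 * (1 + 4 / 9 * s) + η ^ 2 * ‖plaqCovDeriv η U₀ A μ ν x‖) := by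
        rw [← hD]; linarith
    _ = (1 + 4 * u) * ‖P‖ + η ^ 2 * ‖plaqCovDeriv η U₀ A μ ν x‖ + s ^ 2 / 2 * (1 + 4 / 9 * s) := by ring

/-- **(1.141) IN PRINT'S LETTERS at level `j`, LOCAL**: for `U1`-valued `U₀`, `U₁ = e^{iηA}` `U1`-valued, and ON THE
FOUR SIDES of the plaquette `|U₁ − 1| ≤ α₂(Lʲη)⁻¹η`, `|A| ≤ α₂(Lʲη)⁻¹`, at its two gradient entries
`|∇^η_{U₀}A| ≤ α₂(Lʲη)⁻²`, with `4α₂(Lʲη)⁻¹η ≤ 1`: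
`|(U₁U₀)(∂p) − 1| ≤ (1 + 4α₂(Lʲη)⁻¹η)|U₀(∂p) − 1| + (2α₂ + 8α₂²(1 + (16/9)α₂(Lʲη)⁻¹η))·η²(Lʲη)⁻²`.
[cite: Balaban1985RegularSpaces, (1.141) p.100] -/
theorem ineq1141_loc {η : ℝ} (hη : 0 < η) {U₀ : Site d → Fin d → 𝔸ˣ} (h₀ : ∀ y κ, U₀ y κ ∈ U1 𝔸)
    {A : Site d → Fin d → 𝔸} (h₁ : ∀ y κ, expCfg (iEta η A) y κ ∈ U1 𝔸) {L j : ℕ} {α₂ : ℝ} (hα₂ : 0 ≤ α₂)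
    {μ ν : Fin d} {x : Site d}
    (hu : ∀ y τ, IsSide x μ ν y τ → ‖(expCfg (iEta η A) y τ : 𝔸) - 1‖ ≤ α₂ * ((L : ℝ) ^ j * η)⁻¹ * η)
    (hA : ∀ y τ, IsSide x μ ν y τ → ‖A y τ‖ ≤ α₂ * ((L : ℝ) ^ j * η)⁻¹)
    (hG₁ : ‖covDerivFwd η U₀ μ (fun z => A z ν) x‖ ≤ α₂ * (((L : ℝ) ^ j * η)⁻¹) ^ 2)
    (hG₂ : ‖covDerivFwd η U₀ ν (fun z => A z μ) x‖ ≤ α₂ * (((L : ℝ) ^ j * η)⁻¹) ^ 2)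
    (hsmall : 4 * (α₂ * ((L : ℝ) ^ j * η)⁻¹ * η) ≤ 1) :
    ‖plaqF (mulCfg (expCfg (iEta η A)) U₀) μ ν x - 1‖ ≤
      (1 + 4 * (α₂ * ((L : ℝ) ^ j * η)⁻¹ * η)) * ‖plaqF U₀ μ ν x - 1‖ +
        (2 * α₂ + 8 * α₂ ^ 2 * (1 + 16 / 9 * (α₂ * ((L : ℝ) ^ j * η)⁻¹ * η))) *
          (η ^ 2 * (((L : ℝ) ^ j * η)⁻¹) ^ 2) := by
  set r : ℝ := ((L : ℝ) ^ j * η)⁻¹ with hr_def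
  have hr : 0 ≤ r := inv_nonneg.mpr (by positivity)
  set a : ℝ := α₂ * r * η
  have ha : 0 ≤ a := by positivity
  set s := η * (‖A x μ‖ + ‖A (x + e μ) ν‖ + ‖A (x + e ν) μ‖ + ‖A x ν‖)
  have hs0 : 0 ≤ s := by positivity
  have hs4 : s ≤ 4 * a := by
    have h1 := hA _ _ (isSide₁ x μ ν); have h2 := hA _ _ (isSide₂ x μ ν)
    have h3 := hA _ _ (isSide₃ x μ ν); have h4 := hA _ _ (isSide₄ x μ ν)
    have : ‖A x μ‖ + ‖A (x + e μ) ν‖ + ‖A (x + e ν) μ‖ + ‖A x ν‖ ≤ 4 * (α₂ * r) := by linarith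
    calc s ≤ η * (4 * (α₂ * r)) := mul_le_mul_of_nonneg_left this hη.le
      _ = 4 * a := by ring
  have hs1 : s ≤ 1 := hs4.trans hsmall
  have hpt := ineq1141_pointwise_loc hη h₀ A h₁ hu hs1
  have hD : η ^ 2 * ‖plaqCovDeriv η U₀ A μ ν x‖ ≤ 2 * α₂ * (η ^ 2 * r ^ 2) := by
    have : ‖plaqCovDeriv η U₀ A μ ν x‖ ≤ 2 * (α₂ * r ^ 2) := by
      rw [plaqCovDeriv_eq_covDerivFwd]
      exact (norm_sub_le _ _).trans (by linarith [hG₁, hG₂])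
    nlinarith [sq_nonneg η]
  have hS : s ^ 2 / 2 * (1 + 4 / 9 * s) ≤ 8 * α₂ ^ 2 * (1 + 16 / 9 * a) * (η ^ 2 * r ^ 2) := by
    have h1 : s ^ 2 / 2 * (1 + 4 / 9 * s) ≤ (4 * a) ^ 2 / 2 * (1 + 4 / 9 * (4 * a)) := by gcongr
    refine h1.trans_eq ?_
    simp only [a]; ring
  calc ‖plaqF (mulCfg (expCfg (iEta η A)) U₀) μ ν x - 1‖
      ≤ (1 + 4 * a) * ‖plaqF U₀ μ ν x - 1‖ + η ^ 2 * ‖plaqCovDeriv η U₀ A μ ν x‖ +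
          s ^ 2 / 2 * (1 + 4 / 9 * s) := hpt
    _ ≤ (1 + 4 * a) * ‖plaqF U₀ μ ν x - 1‖ + 2 * α₂ * (η ^ 2 * r ^ 2) +
          8 * α₂ ^ 2 * (1 + 16 / 9 * a) * (η ^ 2 * r ^ 2) := by linarith
    _ = (1 + 4 * a) * ‖plaqF U₀ μ ν x - 1‖ + (2 * α₂ + 8 * α₂ ^ 2 * (1 + 16 / 9 * a)) * (η ^ 2 * r ^ 2) := by
        ring

/-- **«α₀ + 2α₂ + 8α₂² ≦ α₀ + 3α₂»: the plaquette clause (1.7) of (1.144) at level `j`, LOCAL.**  Under the hypotheses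
of `ineq1141_loc` with `α₂ ≤ 1/20`, `0 ≤ α₀ ≤ 1/8`, `L ≥ 1`, and the STRICT (1.139) `|U₀(∂p) − 1| < α₀L^{−2j}` at the
plaquette: `|(U₁U₀)(∂p) − 1| < (α₀ + 3α₂)L^{−2j}`. [cite: Balaban1985RegularSpaces, (1.144) p.100 (with (1.7) p.77)] -/
theorem ineq1141_lt_loc {η : ℝ} (hη : 0 < η) {U₀ : Site d → Fin d → 𝔸ˣ} (h₀ : ∀ y κ, U₀ y κ ∈ U1 𝔸)
    {A : Site d → Fin d → 𝔸} (h₁ : ∀ y κ, expCfg (iEta η A) y κ ∈ U1 𝔸) {L : ℕ} (hL : 1 ≤ L) {j : ℕ}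
    {α₀ α₂ : ℝ} (hα₀ : 0 ≤ α₀) (hα₀c : α₀ ≤ 1 / 8) (hα₂ : 0 ≤ α₂) (hα₂c : α₂ ≤ 1 / 20)
    {μ ν : Fin d} {x : Site d}
    (hu : ∀ y τ, IsSide x μ ν y τ → ‖(expCfg (iEta η A) y τ : 𝔸) - 1‖ ≤ α₂ * ((L : ℝ) ^ j * η)⁻¹ * η)
    (hA : ∀ y τ, IsSide x μ ν y τ → ‖A y τ‖ ≤ α₂ * ((L : ℝ) ^ j * η)⁻¹)
    (hG₁ : ‖covDerivFwd η U₀ μ (fun z => A z ν) x‖ ≤ α₂ * (((L : ℝ) ^ j * η)⁻¹) ^ 2)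
    (hG₂ : ‖covDerivFwd η U₀ ν (fun z => A z μ) x‖ ≤ α₂ * (((L : ℝ) ^ j * η)⁻¹) ^ 2)
    (hp : ‖plaqF U₀ μ ν x - 1‖ < α₀ * (((L : ℝ) ^ j)⁻¹) ^ 2) :
    ‖plaqF (mulCfg (expCfg (iEta η A)) U₀) μ ν x - 1‖ < (α₀ + 3 * α₂) * (((L : ℝ) ^ j)⁻¹) ^ 2 := by
  set r : ℝ := ((L : ℝ) ^ j * η)⁻¹ with hr_def
  have hr : 0 < r := inv_pos.mpr (by positivity)
  have ht1 : r * η ≤ 1 := inv_mul_eta_le_one hL hη j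
  have ht0 : 0 ≤ r * η := by positivity
  have hunits : η ^ 2 * r ^ 2 = (((L : ℝ) ^ j)⁻¹) ^ 2 := eta_sq_mul_inv_sq hη.ne' j
  have ha : α₂ * r * η ≤ 1 / 20 := by nlinarith
  have hsmall : 4 * (α₂ * r * η) ≤ 1 := by linarith
  have h := ineq1141_loc hη h₀ h₁ hα₂ hu hA hG₁ hG₂ hsmall
  rw [← hunits] at hp ⊢
  have h1 : (1 + 4 * (α₂ * r * η)) * ‖plaqF U₀ μ ν x - 1‖ < (1 + 4 * (α₂ * r * η)) * (α₀ * (η ^ 2 * r ^ 2)) :=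
    mul_lt_mul_of_pos_left hp (by positivity)
  have hslack := plaq_slack_le hα₀ hα₀c hα₂ hα₂c ht0 ht1
  calc ‖plaqF (mulCfg (expCfg (iEta η A)) U₀) μ ν x - 1‖
      < (1 + 4 * (α₂ * r * η)) * (α₀ * (η ^ 2 * r ^ 2)) +
          (2 * α₂ + 8 * α₂ ^ 2 * (1 + 16 / 9 * (α₂ * r * η))) * (η ^ 2 * r ^ 2) := by linarith
    _ = (α₀ + 2 * α₂ + (4 * α₀ * α₂ * (r * η) + 8 * α₂ ^ 2 * (1 + 16 / 9 * (α₂ * (r * η))))) *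
          (η ^ 2 * r ^ 2) := by ring
    _ ≤ (α₀ + 2 * α₂ + α₂) * (η ^ 2 * r ^ 2) := by gcongr
    _ = (α₀ + 3 * α₂) * (η ^ 2 * r ^ 2) := by ring

end Plaquette

/-! ## §2 (1.142) at one bond from the data on the plaquettes through it -/

section Bond

variable {𝔸 : Type*} [NormedRing 𝔸] [NormOneClass 𝔸] [NormedAlgebra ℂ 𝔸] [CompleteSpace 𝔸]

/-- **(1.142), pointwise form, LOCAL** at the bond `b = ⟨x, x + ηe_μ⟩`: «the basic estimate (1.54)» in its local form
`B8Eq154Local.eq154_printed_loc` and the triangle inequality: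
`|D^{η*}_{U₁U₀}∂(U₁U₀)(b)| ≤ |D^{η*}_{U₀}∂U₀(b)| + η²|(D^{η*}_{U₀}D^η_{U₀}A)(b)| + 36dα₂(Lʲη)⁻¹Gη² + 50dα₂³(Lʲη)⁻³η² +
10dα₀α₂(Lʲη)⁻³η²`. [cite: Balaban1985RegularSpaces, (1.142) p.100] -/
theorem ineq1142_pointwise_loc {η : ℝ} (hη : 0 < η) {U₀ : Site d → Fin d → 𝔸ˣ} (h₀ : ∀ y κ, U₀ y κ ∈ U1 𝔸)
    {A : Site d → Fin d → 𝔸} (h₁ : ∀ y κ, expCfg (iEta η A) y κ ∈ U1 𝔸) {L j : ℕ} {α₀ α₂ G : ℝ}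
    (hα₀ : 0 ≤ α₀) (hα₂ : 0 ≤ α₂) (hG0 : 0 ≤ G) {μ : Fin d} {x : Site d}
    (hA : ∀ y τ, BondNear μ x y τ → ‖A y τ‖ ≤ α₂ * ((L : ℝ) ^ j * η)⁻¹)
    (hG : ∀ (y : Site d) (κ τ : Fin d), BondNear μ x y τ → ‖covDerivFwd η U₀ κ (fun z => A z τ) y‖ ≤ G)
    (hu : ∀ y τ, BondNear μ x y τ → ‖(expCfg (iEta η A) y τ : 𝔸) - 1‖ ≤ α₂ * ((L : ℝ) ^ j * η)⁻¹ * η)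
    (hp : ∀ y κ ν, PlaqNear μ x y κ ν → ‖plaqF U₀ κ ν y - 1‖ ≤ α₀ * η ^ 2 * (((L : ℝ) ^ j * η)⁻¹) ^ 2)
    (hsmall : 16 * (α₂ * ((L : ℝ) ^ j * η)⁻¹ * η) ≤ 1)
    (hd : 5 * (α₂ * ((L : ℝ) ^ j * η)⁻¹ * η) * ((d : ℝ) - 1) ≤ 4) :
    ‖covDiv η (mulCfg (expCfg (iEta η A)) U₀) μ x‖ ≤
      ‖covDiv η U₀ μ x‖ + η ^ 2 * ‖pdiv η U₀ (plaqCovDeriv η U₀ A) μ x‖ +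
        (36 * d * (α₂ * ((L : ℝ) ^ j * η)⁻¹) * G * η ^ 2 + 50 * d * α₂ ^ 3 * (((L : ℝ) ^ j * η)⁻¹) ^ 3 * η ^ 2 +
          10 * d * α₀ * α₂ * (((L : ℝ) ^ j * η)⁻¹) ^ 3 * η ^ 2) := by
  have h := eq154_printed_loc hη h₀ h₁ hα₀ hα₂ hG0 hA hG hu hp hsmall hd
  set T0 := covDiv η (mulCfg (expCfg (iEta η A)) U₀) μ x
  set T1 := covDiv η U₀ μ x
  set P := ((Complex.I : ℂ) * η ^ 2) • pdiv η U₀ (plaqCovDeriv η U₀ A) μ x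
  have hP : ‖P‖ = η ^ 2 * ‖pdiv η U₀ (plaqCovDeriv η U₀ A) μ x‖ := norm_I_eta_sq_smul η _
  have e : T0 = T1 + P + (T0 - T1 - P) := by abel
  calc ‖T0‖ = ‖T1 + P + (T0 - T1 - P)‖ := by rw [← e]
    _ ≤ ‖T1‖ + ‖P‖ + ‖T0 - T1 - P‖ := norm_add₃_le
    _ ≤ _ := by rw [hP]; linarith

/-- **«α₀ + α₂ + 36dα₂² + 50dα₂³ + 10dα₀α₂ ≦ α₀ + 2α₂»: the bond clause (1.9) of (1.144) at level `j`, LOCAL.**  For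
`U1`-valued `U₀`, `U₁ = e^{iηA}` `U1`-valued, `0 ≤ α₀, α₂ ≤ 1/(80d)`, `L ≥ 1`, and, on the `BondNear` bonds of `b`,
`|A| ≤ α₂(Lʲη)⁻¹`, `|U₁ − 1| ≤ α₂(Lʲη)⁻¹η`, at the gradient entries based there `|∇^η_{U₀}A| ≤ α₂(Lʲη)⁻²`, on the
plaquettes through `b` `|U₀(∂p) − 1| ≤ α₀η²(Lʲη)⁻²`, at `b` itself the STRICT (1.9) `|D^{η*}_{U₀}∂U₀(b)| <
α₀L^{−2j}(Lʲη)⁻¹` and `|D^{η*}_{U₀}D^η_{U₀}A(b)| ≤ α₂(Lʲη)⁻³`: `|D^{η*}_{U₁U₀}∂(U₁U₀)(b)| < (α₀ + 2α₂)L^{−2j}(Lʲη)⁻¹`.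
[cite: Balaban1985RegularSpaces, (1.142), (1.144) p.100 (with (1.9) p.77)] -/
theorem ineq1142_lt_loc {η : ℝ} (hη : 0 < η) {U₀ : Site d → Fin d → 𝔸ˣ} (h₀ : ∀ y κ, U₀ y κ ∈ U1 𝔸)
    {A : Site d → Fin d → 𝔸} (h₁ : ∀ y κ, expCfg (iEta η A) y κ ∈ U1 𝔸) {L : ℕ} (hL : 1 ≤ L) {j : ℕ}
    {α₀ α₂ : ℝ} (hα₀ : 0 ≤ α₀) (hα₀c : α₀ ≤ 1 / (80 * d)) (hα₂ : 0 ≤ α₂) (hα₂c : α₂ ≤ 1 / (80 * d))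
    {μ : Fin d} {x : Site d}
    (hA : ∀ y τ, BondNear μ x y τ → ‖A y τ‖ ≤ α₂ * ((L : ℝ) ^ j * η)⁻¹)
    (hG : ∀ (y : Site d) (κ τ : Fin d), BondNear μ x y τ →
      ‖covDerivFwd η U₀ κ (fun z => A z τ) y‖ ≤ α₂ * (((L : ℝ) ^ j * η)⁻¹) ^ 2)
    (hu : ∀ y τ, BondNear μ x y τ → ‖(expCfg (iEta η A) y τ : 𝔸) - 1‖ ≤ α₂ * ((L : ℝ) ^ j * η)⁻¹ * η)
    (hp : ∀ y κ ν, PlaqNear μ x y κ ν → ‖plaqF U₀ κ ν y - 1‖ ≤ α₀ * η ^ 2 * (((L : ℝ) ^ j * η)⁻¹) ^ 2)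
    (h9 : ‖covDiv η U₀ μ x‖ < α₀ * (((L : ℝ) ^ j)⁻¹) ^ 2 * ((L : ℝ) ^ j * η)⁻¹)
    (hDDA : ‖pdiv η U₀ (plaqCovDeriv η U₀ A) μ x‖ ≤ α₂ * (((L : ℝ) ^ j * η)⁻¹) ^ 3) :
    ‖covDiv η (mulCfg (expCfg (iEta η A)) U₀) μ x‖ <
      (α₀ + 2 * α₂) * ((((L : ℝ) ^ j)⁻¹) ^ 2 * ((L : ℝ) ^ j * η)⁻¹) := by
  have hd1 : 1 ≤ d := Fin.pos μ
  have hd1' : (1 : ℝ) ≤ d := by exact_mod_cast hd1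
  set r : ℝ := ((L : ℝ) ^ j * η)⁻¹ with hr_def
  have hr : 0 < r := inv_pos.mpr (by positivity)
  have ht1 : r * η ≤ 1 := inv_mul_eta_le_one hL hη j
  have hunits : η ^ 2 * r ^ 3 = (((L : ℝ) ^ j)⁻¹) ^ 2 * r := eta_sq_mul_inv_cube hη.ne' j
  have h80 : (0 : ℝ) < 80 * d := by positivity
  have hα₂80 : α₂ ≤ 1 / 80 := hα₂c.trans (one_div_le_one_div_of_le (by norm_num) (by linarith))
  have hdα₂ : (d : ℝ) * α₂ ≤ 1 / 80 := by
    have := hα₂c; rw [le_div_iff₀ h80] at this; nlinarith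
  have ha : α₂ * r * η ≤ α₂ := by nlinarith
  have hsmall : 16 * (α₂ * r * η) ≤ 1 := by nlinarith
  have hd' : 5 * (α₂ * r * η) * ((d : ℝ) - 1) ≤ 4 := by
    have : 0 ≤ (d : ℝ) - 1 := by linarith
    have h1 : 5 * (α₂ * r * η) * ((d : ℝ) - 1) ≤ 5 * α₂ * ((d : ℝ) - 1) := by nlinarith
    nlinarith
  have hG0 : 0 ≤ α₂ * r ^ 2 := by positivity
  have h := ineq1142_pointwise_loc hη h₀ h₁ hα₀ hα₂ hG0 hA hG hu hp hsmall hd'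
  have h9' : ‖covDiv η U₀ μ x‖ < α₀ * (η ^ 2 * r ^ 3) := by rw [hunits, ← mul_assoc]; exact h9
  rw [← hunits]
  have h2 : η ^ 2 * ‖pdiv η U₀ (plaqCovDeriv η U₀ A) μ x‖ ≤ η ^ 2 * (α₂ * r ^ 3) :=
    mul_le_mul_of_nonneg_left hDDA (sq_nonneg η)
  have hslack := bond_slack_le hd1 hα₀c hα₂ hα₂c
  calc ‖covDiv η (mulCfg (expCfg (iEta η A)) U₀) μ x‖
      < α₀ * (η ^ 2 * r ^ 3) + η ^ 2 * (α₂ * r ^ 3) +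
          (36 * d * (α₂ * r) * (α₂ * r ^ 2) * η ^ 2 + 50 * d * α₂ ^ 3 * r ^ 3 * η ^ 2 +
            10 * d * α₀ * α₂ * r ^ 3 * η ^ 2) := by linarith
    _ = (α₀ + α₂ + (36 * d * α₂ ^ 2 + 50 * d * α₂ ^ 3 + 10 * d * α₀ * α₂)) * (η ^ 2 * r ^ 3) := by ring
    _ ≤ (α₀ + α₂ + α₂) * (η ^ 2 * r ^ 3) := by gcongr
    _ = (α₀ + 2 * α₂) * (η ^ 2 * r ^ 3) := by ring

end Bond

/-! ## §3 (1.144), `𝔄_k`-clause, level by level for a general family `{Ω_j}` -/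

section ClassAk

variable {𝔸 : Type*} [NormedRing 𝔸] [NormOneClass 𝔸] [NormedAlgebra ℂ 𝔸] [CompleteSpace 𝔸]

/-- **(1.144), `𝔄`-clause AT ONE LEVEL `j` ON ONE SET `S`, from the LEVEL-`j` data on `S`**: for `U1`-valued `U₀`,
`U₁ = e^{iηA}` `U1`-valued, `η > 0`, `L ≥ 1`, `0 ≤ α₀, α₂ ≤ 1/(80d)`: if (1.7)/(1.9) hold for `U₀` at level `j` on
`S` (`CondAt L η α₀ j S U₀`), (1.140) holds at level `j` on `S` (`Cond140`) and `|U₁ − 1| ≤ α₂(Lʲη)⁻¹η` on the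
`SideTouches S` bonds (print's bookkeeping of (1.41); automatic for Hermitian `A`, §5), then (1.7)/(1.9) hold for `U₁U₀`
at level `j` on `S` with `α₀ + 3α₂`. [cite: Balaban1985RegularSpaces, (1.144) p.100] -/
theorem condAt_mulCfg_loc {η : ℝ} (hη : 0 < η) {L : ℕ} (hL : 1 ≤ L) {j : ℕ} {U₀ : Site d → Fin d → 𝔸ˣ}
    (h₀ : ∀ y κ, U₀ y κ ∈ U1 𝔸) {A : Site d → Fin d → 𝔸} (h₁ : ∀ y κ, expCfg (iEta η A) y κ ∈ U1 𝔸)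
    {α₀ α₂ : ℝ} (hα₀ : 0 ≤ α₀) (hα₀c : α₀ ≤ 1 / (80 * d)) (hα₂ : 0 ≤ α₂) (hα₂c : α₂ ≤ 1 / (80 * d))
    {S : Set (Site d)} (h139 : CondAt L η α₀ j S U₀) (h140 : Cond140 L η α₂ j S U₀ A)
    (hu : ∀ y τ, SideTouches S y τ → ‖(expCfg (iEta η A) y τ : 𝔸) - 1‖ ≤ α₂ * ((L : ℝ) ^ j * η)⁻¹ * η) :
    CondAt L η (α₀ + 3 * α₂) j S (mulCfg (expCfg (iEta η A)) U₀) := by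
  obtain ⟨hA, hG, hDDA⟩ := h140
  constructor
  · intro x μ ν hμν hpt
    have hd1 : 1 ≤ d := Fin.pos μ
    have hd1' : (1 : ℝ) ≤ d := by exact_mod_cast hd1
    have hα₀c' : α₀ ≤ 1 / 8 := hα₀c.trans (one_div_le_one_div_of_le (by norm_num) (by linarith))
    have hα₂c' : α₂ ≤ 1 / 20 := hα₂c.trans (one_div_le_one_div_of_le (by norm_num) (by linarith))
    have hside : ∀ y τ, IsSide x μ ν y τ → SideTouches S y τ := fun y τ hs => sideTouches_of_plaqTouches hμν hpt hs
    exact ineq1141_lt_loc hη h₀ h₁ hL hα₀ hα₀c' hα₂ hα₂c' (fun y τ hs => hu y τ (hside y τ hs))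
      (fun y τ hs => (hA y τ (hside y τ hs)).le) (hG _ _ _ (hside _ _ (isSide₄ x μ ν))).le
      (hG _ _ _ (hside _ _ (isSide₁ x μ ν))).le (h139.1 x μ ν hμν hpt)
  · intro x μ hbt
    have hp : ∀ y κ ν, PlaqNear μ x y κ ν → ‖plaqF U₀ κ ν y - 1‖ ≤ α₀ * η ^ 2 * (((L : ℝ) ^ j * η)⁻¹) ^ 2 := by
      intro y κ ν hq
      have h := (h139.1 y κ ν hq.1 (plaqTouches_of_plaqNear hbt hq)).le
      rwa [← eta_sq_mul_inv_sq (L := L) hη.ne' j, ← mul_assoc] at h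
    have h := ineq1142_lt_loc hη h₀ h₁ hL hα₀ hα₀c hα₂ hα₂c
      (fun y τ hn => (hA y τ (sideTouches_of_bondNear hbt hn)).le)
      (fun y κ τ hn => (hG y κ τ (sideTouches_of_bondNear hbt hn)).le)
      (fun y τ hn => hu y τ (sideTouches_of_bondNear hbt hn)) hp (h139.2 x μ hbt) (hDDA x μ hbt).le
    refine h.trans_le ?_
    have : 0 ≤ (((L : ℝ) ^ j)⁻¹) ^ 2 * ((L : ℝ) ^ j * η)⁻¹ := by positivity
    rw [mul_assoc]
    gcongr
    linarith

/-- **(1.144), `𝔄_k`-clause FOR A GENERAL FAMILY `{Ω_j}_{j ≤ k}`: `U₁U₀ ∈ 𝔄_k({Ω_j}, α₀ + 3α₂)`** from print's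
LEVEL-WISE hypotheses (1.139) `U₀ ∈ 𝔄_k({Ω_j}, α₀)` and (1.140) on `Ω_j` for every `j ≤ k` (`Cond140`, HONEST SCOPE
(i)), the (1.41)-bookkeeping `|U₁ − 1| ≤ α₂(Lʲη)⁻¹η` on `SideTouches Ω_j`, and `0 ≤ α₀, α₂ ≤ 1/(80d)`.
[cite: Balaban1985RegularSpaces, Prop. 7 (1.144) p.100] -/
theorem inAk_mulCfg_loc {η : ℝ} (hη : 0 < η) {L : ℕ} (hL : 1 ≤ L) {k : ℕ} {U₀ : Site d → Fin d → 𝔸ˣ}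
    (h₀ : ∀ y κ, U₀ y κ ∈ U1 𝔸) {A : Site d → Fin d → 𝔸} (h₁ : ∀ y κ, expCfg (iEta η A) y κ ∈ U1 𝔸)
    {α₀ α₂ : ℝ} (hα₀ : 0 ≤ α₀) (hα₀c : α₀ ≤ 1 / (80 * d)) (hα₂ : 0 ≤ α₂) (hα₂c : α₂ ≤ 1 / (80 * d))
    {Ω : ℕ → Set (Site d)} (h139 : InAk L k η α₀ Ω U₀) (h140 : ∀ j, j ≤ k → Cond140 L η α₂ j (Ω j) U₀ A)
    (hu : ∀ j, j ≤ k → ∀ y τ, SideTouches (Ω j) y τ →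
      ‖(expCfg (iEta η A) y τ : 𝔸) - 1‖ ≤ α₂ * ((L : ℝ) ^ j * η)⁻¹ * η) :
    InAk L k η (α₀ + 3 * α₂) Ω (mulCfg (expCfg (iEta η A)) U₀) :=
  fun j hjk => condAt_mulCfg_loc hη hL h₀ h₁ hα₀ hα₀c hα₂ hα₂c (h139 j hjk) (h140 j hjk) (hu j hjk)

omit [CompleteSpace 𝔸] in
/-- **(1.144): `U′U₀ = (U₁U₀)^u ∈ 𝔄_k({Ω_j}, α₀ + 3α₂)` for EVERY `U1`-valued gauge transformation `u`** (in
particular print's `u` of (1.29)/(1.19)), for a general family `{Ω_j}` from the level-wise (1.139)/(1.140), by the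
gauge invariance of `𝔄_k` (p. 77, `B8Ineq132.inAk_gaugeAct_iff`). [cite: Balaban1985RegularSpaces, Prop. 7 (1.144) p.100] -/
theorem inAk_mulCfg_gaugeAct_loc [CompleteSpace 𝔸] {η : ℝ} (hη : 0 < η) {L : ℕ} (hL : 1 ≤ L) {k : ℕ}
    {U₀ : Site d → Fin d → 𝔸ˣ} (h₀ : ∀ y κ, U₀ y κ ∈ U1 𝔸) {A : Site d → Fin d → 𝔸}
    (h₁ : ∀ y κ, expCfg (iEta η A) y κ ∈ U1 𝔸) {α₀ α₂ : ℝ} (hα₀ : 0 ≤ α₀) (hα₀c : α₀ ≤ 1 / (80 * d))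
    (hα₂ : 0 ≤ α₂) (hα₂c : α₂ ≤ 1 / (80 * d)) {Ω : ℕ → Set (Site d)} (h139 : InAk L k η α₀ Ω U₀)
    (h140 : ∀ j, j ≤ k → Cond140 L η α₂ j (Ω j) U₀ A)
    (hu : ∀ j, j ≤ k → ∀ y τ, SideTouches (Ω j) y τ →
      ‖(expCfg (iEta η A) y τ : 𝔸) - 1‖ ≤ α₂ * ((L : ℝ) ^ j * η)⁻¹ * η)
    {u : Site d → 𝔸ˣ} (hu1 : ∀ x, u x ∈ U1 𝔸) :
    InAk L k η (α₀ + 3 * α₂) Ω (gaugeAct u (mulCfg (expCfg (iEta η A)) U₀)) :=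
  (inAk_gaugeAct_iff L k η _ Ω hu1 _).2 (inAk_mulCfg_loc hη hL h₀ h₁ hα₀ hα₀c hα₂ hα₂c h139 h140 hu)

end ClassAk

end Literature.MathematicalPhysics.QuantumFieldTheory.Balaban1983to89.B8Prop7ClassAkLocal

/-! ## §4 The Hermitian case: `A` self-adjoint in a C⋆-algebra (print: `A` `𝔤`-valued, `𝔤 ⊂ u(N)`, `U₀` unitary) -/

namespace Literature.MathematicalPhysics.QuantumFieldTheory.Balaban1983to89.B8Prop7ClassAkLocal

open B7Prop1Explicit
open B8Lemma1NonAbelian (mulCfg)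
open B8Ineq132 (CondAt InAk)
open B8Eq146AExpansion (expCfg iEta)
open B8Eq155JBound (expCfg_iEta_mem_U1 norm_expCfg_iEta_sub_one_le)
open B8Eq140Level (SideTouches Cond140)

variable {d : ℕ} {𝔸 : Type*} [CStarAlgebra 𝔸] [Nontrivial 𝔸]

omit [Nontrivial 𝔸] in
/-- The (1.41)-bookkeeping for Hermitian `A` from the first member of (1.140): `|e^{iηA(b)} − 1| ≤ η|A(b)| ≤
α₂(Lʲη)⁻¹η` on the `SideTouches` bonds of `S`. [cite: Balaban1985RegularSpaces, (1.41) p.83, (1.140) p.100] -/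
theorem norm_expCfg_sub_one_of_cond140 {η : ℝ} (hη : 0 ≤ η) {A : Site d → Fin d → 𝔸}
    (hAh : ∀ y κ, IsSelfAdjoint (A y κ)) {L j : ℕ} {α₂ : ℝ} {S : Set (Site d)} {U₀ : Site d → Fin d → 𝔸ˣ}
    (h140 : Cond140 L η α₂ j S U₀ A) (y : Site d) (τ : Fin d) (hy : SideTouches S y τ) :
    ‖(expCfg (iEta η A) y τ : 𝔸) - 1‖ ≤ α₂ * ((L : ℝ) ^ j * η)⁻¹ * η :=
  (norm_expCfg_iEta_sub_one_le hη hAh y τ).trans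
    ((mul_le_mul_of_nonneg_left (h140.1 y τ hy).le hη).trans_eq (mul_comm _ _))

/-- **(1.144), `𝔄_k`-clause, for Hermitian `A` and a general family `{Ω_j}`: `U₁U₀ ∈ 𝔄_k({Ω_j}, α₀ + 3α₂)`** from
`U₀ ∈ 𝔄_k({Ω_j}, α₀)` (1.139), (1.140) on every `Ω_j` and `0 ≤ α₀, α₂ ≤ 1/(80d)` (`U₁ = e^{iηA}` unitary,
`|U₁ − 1| ≤ η|A|` discharged). [cite: Balaban1985RegularSpaces, Prop. 7 (1.144) p.100] -/
theorem inAk_mulCfg_hermitian_loc {η : ℝ} (hη : 0 < η) {L : ℕ} (hL : 1 ≤ L) {k : ℕ}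
    {U₀ : Site d → Fin d → 𝔸ˣ} (h₀ : ∀ y κ, U₀ y κ ∈ U1 𝔸) {A : Site d → Fin d → 𝔸}
    (hAh : ∀ y κ, IsSelfAdjoint (A y κ)) {α₀ α₂ : ℝ} (hα₀ : 0 ≤ α₀) (hα₀c : α₀ ≤ 1 / (80 * d))
    (hα₂ : 0 ≤ α₂) (hα₂c : α₂ ≤ 1 / (80 * d)) {Ω : ℕ → Set (Site d)} (h139 : InAk L k η α₀ Ω U₀)
    (h140 : ∀ j, j ≤ k → Cond140 L η α₂ j (Ω j) U₀ A) :
    InAk L k η (α₀ + 3 * α₂) Ω (mulCfg (expCfg (iEta η A)) U₀) :=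
  inAk_mulCfg_loc hη hL h₀ (expCfg_iEta_mem_U1 η hAh) hα₀ hα₀c hα₂ hα₂c h139 h140
    fun j hjk => norm_expCfg_sub_one_of_cond140 hη.le hAh (h140 j hjk)

/-- **(1.144) for Hermitian `A` and a general family `{Ω_j}`: `U′U₀ = (U₁U₀)^u ∈ 𝔄_k({Ω_j}, α₀ + 3α₂)` for every
`U1`-valued gauge transformation `u`** (in particular print's axial `u`). [cite: Balaban1985RegularSpaces, Prop. 7 (1.144) p.100] -/
theorem inAk_mulCfg_gaugeAct_hermitian_loc {η : ℝ} (hη : 0 < η) {L : ℕ} (hL : 1 ≤ L) {k : ℕ}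
    {U₀ : Site d → Fin d → 𝔸ˣ} (h₀ : ∀ y κ, U₀ y κ ∈ U1 𝔸) {A : Site d → Fin d → 𝔸}
    (hAh : ∀ y κ, IsSelfAdjoint (A y κ)) {α₀ α₂ : ℝ} (hα₀ : 0 ≤ α₀) (hα₀c : α₀ ≤ 1 / (80 * d))
    (hα₂ : 0 ≤ α₂) (hα₂c : α₂ ≤ 1 / (80 * d)) {Ω : ℕ → Set (Site d)} (h139 : InAk L k η α₀ Ω U₀)
    (h140 : ∀ j, j ≤ k → Cond140 L η α₂ j (Ω j) U₀ A) {u : Site d → 𝔸ˣ} (hu1 : ∀ x, u x ∈ U1 𝔸) :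
    InAk L k η (α₀ + 3 * α₂) Ω (gaugeAct u (mulCfg (expCfg (iEta η A)) U₀)) :=
  inAk_mulCfg_gaugeAct_loc hη hL h₀ (expCfg_iEta_mem_U1 η hAh) hα₀ hα₀c hα₂ hα₂c h139 h140
    (fun j hjk => norm_expCfg_sub_one_of_cond140 hη.le hAh (h140 j hjk)) hu1

/-- **Proposition 7, the `𝔄_k`-clause of (1.144), in the sentence shape of the abstract leaf
`B8SectGH.Prop7PrintedR`, WITH PRINT'S LEVEL-WISE HYPOTHESES** («for α₀, α₂ sufficiently small» = `∃ c > 0, ∀ α₀, α₂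
∈ (0, c]`; here `c = 1/(80d)`, `d ≥ 1`) on the `ℤ^d` carriers, `𝔸` a C⋆-algebra, `A` Hermitian, `U₀` `U1`-valued,
`η > 0`, `L ≥ 1`: if `U₀ ∈ 𝔄_k({Ω_j}, α₀)` (1.139) and `A` satisfies (1.140) on `Ω_j` for `j = 0, 1, …, k` (`Cond140`,
HONEST SCOPE (i)), then `U′U₀ = (U₁U₀)^u ∈ 𝔄_k({Ω_j}, α₀ + 3α₂)` for every `U1`-valued gauge transformation `u`.
[cite: Balaban1985RegularSpaces, Prop. 7 (1.144) p.100] -/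
theorem prop7_classAk_loc (hd : 1 ≤ d) {η : ℝ} (hη : 0 < η) {L : ℕ} (hL : 1 ≤ L) (k : ℕ) :
    ∃ c : ℝ, 0 < c ∧ ∀ α₀ α₂ : ℝ, 0 < α₀ → α₀ ≤ c → 0 < α₂ → α₂ ≤ c →
      ∀ U₀ : Site d → Fin d → 𝔸ˣ, (∀ y κ, U₀ y κ ∈ U1 𝔸) →
        ∀ A : Site d → Fin d → 𝔸, (∀ y κ, IsSelfAdjoint (A y κ)) →
          ∀ Ω : ℕ → Set (Site d), InAk L k η α₀ Ω U₀ → (∀ j, j ≤ k → Cond140 L η α₂ j (Ω j) U₀ A) →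
            ∀ u : Site d → 𝔸ˣ, (∀ x, u x ∈ U1 𝔸) →
              InAk L k η (α₀ + 3 * α₂) Ω (gaugeAct u (mulCfg (expCfg (iEta η A)) U₀)) := by
  refine ⟨1 / (80 * d), by positivity, ?_⟩
  intro α₀ α₂ hα₀ hα₀c hα₂ hα₂c U₀ h₀ A hAh Ω h139 h140 u hu1
  exact inAk_mulCfg_gaugeAct_hermitian_loc hη hL h₀ hAh hα₀.le hα₀c hα₂.le hα₂c h139 h140 hu1

#print axioms condAt_mulCfg_loc
#print axioms inAk_mulCfg_loc
#print axioms inAk_mulCfg_gaugeAct_loc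
#print axioms prop7_classAk_loc

end Literature.MathematicalPhysics.QuantumFieldTheory.Balaban1983to89.B8Prop7ClassAkLocal

end
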